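import Mathlib.Analysis.Convolution
import Literature.MathematicalPhysics.QuantumLattice.LiebWuIntegralEquations
import Literature.MeasureTheory.Lebesgue.SubconvolutionVanishing
import HarnessLib

/-!
# Uniqueness of the `B = ∞` solution of the Lieb–Wu integral equations (Lieb–Wu 2003, Theorem 1)

Family `hubbard`. Lieb–Wu, PRL 20 (1968) 1445, statement (a): "Equations (13)–(16) have a unique
solution which is positive for all allowed `B` and `Q`"; proved in Lieb–Wu, Physica A 321 (2003) 1,
§5, THEOREM 1 ("The solutions `f(x)` and `σ(x)` are unique and positive for all real `x`"), for all
`0 < Q ≤ π`, `0 < B ≤ ∞`, in `L¹`. This file PROVES the uniqueness clause in the case `B = ∞` (the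
absolute ground state, statement (b)) for every `0 < Q ≤ π` and `U > 0`, for the equations AS
PRINTED (`IsLiebWuDensities U Q univ`, file `LiebWuIntegralEquations`):

* `IsLiebWuDensities.sigma_unique` / `.rho_unique`: two `L¹` solutions with the same `U > 0`, `Q` and
  `B = ∞` have the same `σ` (on `ℝ`) and the same `ρ` (on `[-Q, Q]`);
* `IsLiebWuDensities.filling_energyPerSite_unique`: hence the same filling (15) and energy (17).

Existence, positivity, `B < ∞` and the monotonicity statements (b)–(c) of Lieb–Wu 2003 are not treated.

## Proof (Lieb–Wu 2003, §5, proof of Theorem 1, specialised to `B = ∞`)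

`K = K_{U/4}`, `K² = K_{U/2}`, `u` = kernel of `Û = K̂²(1 + K̂²)⁻¹`, `r/2` = kernel of `R̂ = K̂(1 + K̂²)⁻¹`
(`cauchyDensity`, `fermiKernel`, `sechKernel`; PROVED identities `u ∗ K² = K² - u`, `u ∗ K = K - r/2`,
`r ∗ K = 2u` in `LiebWuKernels`). For `δ = σ₁ - σ₂ ∈ L¹(ℝ)`, (13) gives `ρ₁ - ρ₂ = cos k · G(sin k)` on
`[-Q, Q]`, `G = δ ∗ K`; (14) with the substitution `x = sin k` (Lieb–Wu's reduction to `|x| ≤ a = sin Q`)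
reads `δ = (1_{[-a,a]} G) ∗ K - δ ∗ K²`. Convolving with `u` ("applying `(1 + K̂²)⁻¹ = 1 - Û`", eqs. (S),
(R)) gives `δ = ½ (1_{[-a,a]} G) ∗ r`, so `|δ| ≤ ½ (|δ| ∗ K) ∗ r = |δ| ∗ u`; as `u ≥ 0`, `∫ u = 1/2 < 1`
("`‖Û‖ = 1/2`"), `|δ| = 0` a.e. (`ae_eq_zero_of_le_integral_sub`), hence `G ≡ 0` and `δ ≡ 0`.

## References

* E. H. Lieb, F. Y. Wu, Physica A 321 (2003) 1–27 = arXiv:cond-mat/0207529, §5, Theorem 1 and its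
  proof (eqs. (S), (R), (W); `‖Û‖ = 1/2`) (key `LiebWuPhysicaA2003`).
* E. H. Lieb, F. Y. Wu, Phys. Rev. Lett. 20 (1968) 1445, statement (a) (key `LiebWuPRL1968`).
-/

noncomputable section

open MeasureTheory Set Real Filter intervalIntegral
open Literature.Analysis.SpecialFunctions Literature.MeasureTheory.Lebesgue
open scoped Convolution

namespace Literature.MathematicalPhysics.QuantumLattice

namespace LiebWuConv

/-- The convolution `(f ∗ g)(x) = ∫ f(t) g(x - t) dt` on `ℝ` (plumbing notation for this file).
[folklore] -/
def conv (f g : ℝ → ℝ) (x : ℝ) : ℝ := ∫ t, f t * g (x - t)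

variable {f f₁ f₂ g g₁ g₂ k : ℝ → ℝ} {B B' : ℝ}

/-- `conv` is Mathlib's convolution for the multiplication pairing. [folklore] -/
private theorem conv_eq_convolution (f g : ℝ → ℝ) :
    conv f g = f ⋆[ContinuousLinearMap.mul ℝ ℝ, volume] g := by
  funext x
  rw [conv, convolution_def]
  simp only [ContinuousLinearMap.mul_apply']

/-- Commutativity: `∫ f(t) g(x - t) dt = ∫ g(t) f(x - t) dt`. [folklore] -/
private theorem conv_comm (f g : ℝ → ℝ) (x : ℝ) : conv f g x = conv g f x := by
  rw [conv, conv, ← integral_sub_left_eq_self (fun t => f t * g (x - t)) volume x]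
  refine MeasureTheory.integral_congr_ae (Eventually.of_forall fun t => ?_)
  simp only [sub_sub_cancel]
  ring

/-- The integrand `t ↦ f(t) g(x - t)` is integrable for `f ∈ L¹`, `g` bounded continuous. [folklore] -/
private theorem integrable_mul_sub (hf : Integrable f) (hgc : Continuous g) (hgB : ∀ y, |g y| ≤ B)
    (x : ℝ) : Integrable fun t => f t * g (x - t) :=
  hf.mul_bdd (hgc.comp (continuous_const.sub continuous_id)).aestronglyMeasurable
    (Eventually.of_forall fun t => by rw [Real.norm_eq_abs]; exact hgB _)

/-- `conv f g ∈ L¹` for `f, g ∈ L¹`. [folklore] -/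
private theorem integrable_conv (hf : Integrable f) (hg : Integrable g) : Integrable (conv f g) := by
  rw [conv_eq_convolution]
  exact hf.integrable_convolution _ hg

/-- `conv f g` is continuous for `f ∈ L¹`, `g` bounded continuous. [folklore] -/
private theorem continuous_conv (hf : Integrable f) (hgc : Continuous g) (hgB : ∀ y, |g y| ≤ B) :
    Continuous (conv f g) := by
  rw [conv_eq_convolution]
  refine BddAbove.continuous_convolution_right_of_integrable (L := ContinuousLinearMap.mul ℝ ℝ)
    ⟨B, ?_⟩ hf hgc
  rintro _ ⟨y, rfl⟩
  show ‖g y‖ ≤ B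
  rw [Real.norm_eq_abs]
  exact hgB y

/-- Linearity in the first argument. [folklore] -/
private theorem conv_sub_left (hf₁ : Integrable f₁) (hf₂ : Integrable f₂) (hgc : Continuous g)
    (hgB : ∀ y, |g y| ≤ B) (x : ℝ) :
    conv (fun t => f₁ t - f₂ t) g x = conv f₁ g x - conv f₂ g x := by
  rw [conv, conv, conv, ← integral_sub (integrable_mul_sub hf₁ hgc hgB x) (integrable_mul_sub hf₂ hgc hgB x)]
  refine MeasureTheory.integral_congr_ae (Eventually.of_forall fun t => ?_)
  ring

/-- Linearity in the second argument. [folklore] -/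
private theorem conv_sub_right (hf : Integrable f) (hg₁c : Continuous g₁) (hg₁B : ∀ y, |g₁ y| ≤ B)
    (hg₂c : Continuous g₂) (hg₂B : ∀ y, |g₂ y| ≤ B') (x : ℝ) :
    conv f (fun y => g₁ y - g₂ y) x = conv f g₁ x - conv f g₂ x := by
  rw [conv, conv, conv, ← integral_sub (integrable_mul_sub hf hg₁c hg₁B x) (integrable_mul_sub hf hg₂c hg₂B x)]
  refine MeasureTheory.integral_congr_ae (Eventually.of_forall fun t => ?_)
  ring

/-- Scalars in the second argument. [folklore] -/
private theorem conv_const_mul_right (f g : ℝ → ℝ) (c x : ℝ) :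
    conv f (fun y => c * g y) x = c * conv f g x := by
  rw [conv, conv, ← MeasureTheory.integral_const_mul]
  refine MeasureTheory.integral_congr_ae (Eventually.of_forall fun t => ?_)
  ring

/-- `|conv f g| ≤ conv |f| g` for `g ≥ 0`. [folklore] -/
private theorem abs_conv_le_conv_abs (hg0 : ∀ y, 0 ≤ g y) (x : ℝ) :
    |conv f g x| ≤ conv (fun t => |f t|) g x := by
  calc |conv f g x| ≤ ∫ t, |f t * g (x - t)| := abs_integral_le_integral_abs
    _ = conv (fun t => |f t|) g x := by
        rw [conv]
        refine MeasureTheory.integral_congr_ae (Eventually.of_forall fun t => ?_)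
        dsimp only
        rw [abs_mul, abs_of_nonneg (hg0 _)]

/-- Monotonicity in the first argument for `g ≥ 0`. [folklore] -/
private theorem conv_mono_left {x : ℝ} (h : ∀ t, f₁ t ≤ f₂ t) (hg0 : ∀ y, 0 ≤ g y)
    (h₁ : Integrable fun t => f₁ t * g (x - t)) (h₂ : Integrable fun t => f₂ t * g (x - t)) :
    conv f₁ g x ≤ conv f₂ g x :=
  integral_mono h₁ h₂ fun t => mul_le_mul_of_nonneg_right (h t) (hg0 _)

/-- **Associativity** `(f ∗ g) ∗ k = f ∗ (g ∗ k)` pointwise, for `f, g ∈ L¹` and `k` bounded continuous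
(Fubini; the double integral converges absolutely). [folklore] -/
private theorem conv_conv (hf : Integrable f) (hgi : Integrable g)
    (hkc : Continuous k) (hkB : ∀ y, |k y| ≤ B') (x : ℝ) :
    conv (conv f g) k x = conv f (conv g k) x := by
  -- the integrand `(y, z) ↦ f(z) g(y - z) k(x - y)` is integrable on `ℝ × ℝ`
  have hprod : Integrable (fun p : ℝ × ℝ => f p.2 * g (p.1 - p.2))
      ((volume : Measure ℝ).prod volume) :=
    hf.convolution_integrand (ContinuousLinearMap.mul ℝ ℝ) hgi
  have hkm : Continuous fun p : ℝ × ℝ => k (x - p.1) := hkc.comp (continuous_const.sub continuous_fst)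
  have h := hprod.mul_bdd (c := B') hkm.aestronglyMeasurable
    (Eventually.of_forall fun p => by rw [Real.norm_eq_abs]; exact hkB _)
  have hF : Integrable (Function.uncurry fun y z => f z * g (y - z) * k (x - y))
      ((volume : Measure ℝ).prod volume) := h
  calc conv (conv f g) k x = ∫ y, (∫ z, f z * g (y - z)) * k (x - y) := rfl
    _ = ∫ y, ∫ z, f z * g (y - z) * k (x - y) := by
        refine MeasureTheory.integral_congr_ae (Eventually.of_forall fun y => ?_)
        exact (MeasureTheory.integral_mul_const (k (x - y)) _).symm
    _ = ∫ z, ∫ y, f z * g (y - z) * k (x - y) := integral_integral_swap hF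
    _ = ∫ z, f z * ∫ s, g s * k (x - z - s) := by
        refine MeasureTheory.integral_congr_ae (Eventually.of_forall fun z => ?_)
        dsimp only
        rw [← MeasureTheory.integral_const_mul,
          ← integral_add_right_eq_self (fun y => f z * g (y - z) * k (x - y)) z]
        refine MeasureTheory.integral_congr_ae (Eventually.of_forall fun s => ?_)
        dsimp only
        rw [add_sub_cancel_right, show x - (s + z) = x - z - s by ring]
        ring
    _ = conv f (conv g k) x := rfl

/-- **The contraction step of Lieb–Wu's proof of Theorem 1 at `B = ∞`.** If `δ ∈ L¹` satisfies
`δ = AG ∗ K - δ ∗ K²` with `|AG| ≤ |δ ∗ K|`, `AG ∈ L¹`, for kernels `K, u, r ≥ 0`, `K²` with `u ∗ K = K - r/2`,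
`u ∗ K² = K² - u`, `r ∗ K = 2u`, `∫ u < 1`, then `δ = 0` a.e. [cite: LiebWuPhysicaA2003, §5, proof of Theorem 1] -/
theorem ae_eq_zero_of_system {δ AG K K2 u r : ℝ → ℝ} {BK BK2 Bu Br : ℝ}
    (hδi : Integrable δ) (hAGi : Integrable AG) (hAGle : ∀ y, |AG y| ≤ |conv δ K y|)
    (hKc : Continuous K) (hKi : Integrable K) (hKB : ∀ y, |K y| ≤ BK) (hK0 : ∀ y, 0 ≤ K y)
    (hK2c : Continuous K2) (hK2i : Integrable K2) (hK2B : ∀ y, |K2 y| ≤ BK2)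
    (huc : Continuous u) (hui : Integrable u) (huB : ∀ y, |u y| ≤ Bu) (hu0 : ∀ y, 0 ≤ u y)
    (hU1 : ∫ x, u x < 1)
    (hrc : Continuous r) (hrB : ∀ y, |r y| ≤ Br) (hr0 : ∀ y, 0 ≤ r y)
    (hKu : ∀ y, conv K u y = K y - r y / 2) (hK2u : ∀ y, conv K2 u y = K2 y - u y)
    (hKr : ∀ y, conv K r y = 2 * u y)
    (hE : ∀ Λ, δ Λ = conv AG K Λ - conv δ K2 Λ) : δ =ᵐ[volume] 0 := by
  have hrB' : ∀ y, |1 / 2 * r y| ≤ 1 / 2 * Br := fun y => by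
    rw [abs_mul, abs_of_pos (by norm_num : (0:ℝ) < 1 / 2)]
    exact mul_le_mul_of_nonneg_left (hrB y) (by norm_num)
  -- "applying `(1 + K̂²)⁻¹ = 1 - Û`": `δ = ½ AG ∗ r`
  have hδr : ∀ Λ, δ Λ = 1 / 2 * conv AG r Λ := by
    intro Λ
    have hfun : (fun y => conv AG K y - δ y) = conv δ K2 := funext fun y => by rw [hE y]; ring
    have hKu' : conv K u = fun y => K y - 1 / 2 * r y := funext fun y => by rw [hKu y]; ring
    have hK2u' : conv K2 u = fun y => K2 y - u y := funext fun y => hK2u y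
    -- `(AG ∗ K) ∗ u = AG ∗ (K ∗ u) = AG ∗ K - ½ AG ∗ r`
    have hl : conv (conv AG K) u Λ = conv AG K Λ - 1 / 2 * conv AG r Λ := by
      rw [conv_conv hAGi hKi huc huB, hKu',
        conv_sub_right hAGi hKc hKB (g₂ := fun y => 1 / 2 * r y) (continuous_const.mul hrc) hrB',
        conv_const_mul_right]
    -- `(AG ∗ K - δ) ∗ u = (δ ∗ K²) ∗ u = δ ∗ (K² - u)`
    have hr' : conv (conv AG K) u Λ - conv δ u Λ = conv δ K2 Λ - conv δ u Λ := by
      rw [← conv_sub_left (integrable_conv hAGi hKi) hδi huc huB, hfun,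
        conv_conv hδi hK2i huc huB, hK2u', conv_sub_right hδi hK2c hK2B huc huB]
    rw [hE Λ]
    linarith [hl, hr']
  -- domination `|δ| ≤ |δ| ∗ u`
  have hδabs : Integrable fun t => |δ t| := hδi.abs
  have hdom : ∀ Λ, |δ Λ| ≤ conv (fun t => |δ t|) u Λ := by
    intro Λ
    have hGabs : ∀ y, |conv δ K y| ≤ conv (fun t => |δ t|) K y := fun y => abs_conv_le_conv_abs hK0 y
    calc |δ Λ| = 1 / 2 * |conv AG r Λ| := by
          rw [hδr Λ, abs_mul, abs_of_pos (by norm_num : (0:ℝ) < 1 / 2)]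
      _ ≤ 1 / 2 * conv (fun t => |AG t|) r Λ :=
          mul_le_mul_of_nonneg_left (abs_conv_le_conv_abs hr0 Λ) (by norm_num)
      _ ≤ 1 / 2 * conv (conv (fun t => |δ t|) K) r Λ :=
          mul_le_mul_of_nonneg_left (conv_mono_left (fun t => (hAGle t).trans (hGabs t)) hr0
            (integrable_mul_sub hAGi.abs hrc hrB Λ)
            (integrable_mul_sub (integrable_conv hδabs hKi) hrc hrB Λ)) (by norm_num)
      _ = 1 / 2 * conv (fun t => |δ t|) (conv K r) Λ := by
          rw [conv_conv hδabs hKi hrc hrB]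
      _ = conv (fun t => |δ t|) u Λ := by
          rw [show conv K r = fun y => 2 * u y from funext hKr, conv_const_mul_right]
          ring
  -- sub-convolution vanishing for a measurable modification of `|δ|`
  set δm : ℝ → ℝ := hδi.1.mk δ with hδm
  have hδm_ae : δ =ᵐ[volume] δm := hδi.1.ae_eq_mk
  have hδm_meas : Measurable δm := hδi.1.stronglyMeasurable_mk.measurable
  set g : ℝ → ℝ := fun y => |δm y| with hg
  have hg_meas : Measurable g := continuous_abs.measurable.comp hδm_meas
  have hg_ae : (fun y => |δ y|) =ᵐ[volume] g := by
    filter_upwards [hδm_ae] with y hy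
    simp only [hg, hy]
  have hgi : Integrable g := hδabs.congr hg_ae
  have hg0 : ∀ y, 0 ≤ g y := fun y => abs_nonneg _
  have hdom' : ∀ᵐ x, g x ≤ ∫ y, u (x - y) * g y := by
    filter_upwards [hδm_ae] with x hx
    have h1 : g x = |δ x| := by simp only [hg, hx]
    have h2 : ∫ y, u (x - y) * g y = conv (fun t => |δ t|) u x := by
      rw [conv]
      refine MeasureTheory.integral_congr_ae ?_
      filter_upwards [hg_ae] with y hy
      rw [← hy, mul_comm]
    rw [h1, h2]
    exact hdom x
  have hg_zero : g =ᵐ[volume] 0 :=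
    ae_eq_zero_of_le_integral_sub huc.measurable hg_meas hu0 hg0 hui hgi hU1 hdom'
  filter_upwards [hδm_ae, hg_zero] with y hy hgy
  simp only [hg, Pi.zero_apply, abs_eq_zero] at hgy
  rw [hy, hgy, Pi.zero_apply]

end LiebWuConv

open LiebWuConv

section Uniqueness

variable {U Q : ℝ} {ρ₁ σ₁ ρ₂ σ₂ : ℝ → ℝ}

/-- (13) at `B = ∞` in convolution form: `ρ(k) = 1/2π + cos k · (σ ∗ K_{U/4})(sin k)` on `[-Q, Q]`.
[cite: LiebWuPhysicaA2003, §4, boxed equation for ρ] -/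
theorem IsLiebWuDensities.rho_eq_conv {ρ σ : ℝ → ℝ} (h : IsLiebWuDensities U Q univ ρ σ) {k : ℝ}
    (hk : k ∈ Icc (-Q) Q) :
    ρ k = 1 / (2 * π) + Real.cos k * conv σ (cauchyDensity (U / 4)) (Real.sin k) := by
  rw [h.rho_eq hk, Measure.restrict_univ, conv]
  congr 2
  exact MeasureTheory.integral_congr_ae (Eventually.of_forall fun t => mul_comm _ _)

/-- (14) at `B = ∞` in convolution form:
`σ(Λ) = ∫_{-Q}^{Q} K_{U/4}(Λ - sin k) ρ(k) dk - (σ ∗ K_{U/2})(Λ)` for all `Λ`.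
[cite: LiebWuPhysicaA2003, §4, boxed equation for σ] -/
theorem IsLiebWuDensities.sigma_eq_conv {ρ σ : ℝ → ℝ} (h : IsLiebWuDensities U Q univ ρ σ) (Λ : ℝ) :
    σ Λ = (∫ k in -Q..Q, cauchyDensity (U / 4) (Λ - Real.sin k) * ρ k) -
      conv σ (cauchyDensity (U / 2)) Λ := by
  rw [h.sigma_eq (mem_univ Λ), Measure.restrict_univ, conv]
  have : (fun Λ' => cauchyDensity (U / 2) (Λ - Λ') * σ Λ') =
      fun t => σ t * cauchyDensity (U / 2) (Λ - t) := by
    funext t; ring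
  rw [this]

/-- **Lieb–Wu 2003, Theorem 1 (uniqueness), case `B = ∞`: the rapidity density is unique.** For
`U > 0`, two `L¹` solutions of the Lieb–Wu equations (13)–(14) with the same momentum cutoff `Q` and
rapidity range `ℝ` have the same `σ`. [cite: LiebWuPhysicaA2003, §5, Theorem 1] -/
theorem IsLiebWuDensities.sigma_unique (hU : 0 < U) (h₁ : IsLiebWuDensities U Q univ ρ₁ σ₁)
    (h₂ : IsLiebWuDensities U Q univ ρ₂ σ₂) : σ₁ = σ₂ := by
  have hc : 0 < U / 4 := by positivity
  have h2c : 0 < U / 2 := by positivity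
  have hU2 : 2 * (U / 4) = U / 2 := by ring
  -- kernel facts
  have hKB' : ∀ {c : ℝ}, 0 < c → ∀ y, |cauchyDensity c y| ≤ 1 / (π * c) := fun hc y => by
    rw [abs_of_pos (cauchyDensity_pos hc y)]; exact cauchyDensity_le hc y
  have hKc : Continuous (cauchyDensity (U / 4)) := continuous_cauchyDensity hc
  have hKB := hKB' hc
  have hK2c : Continuous (cauchyDensity (U / 2)) := continuous_cauchyDensity h2c
  have hK2B := hKB' h2c
  -- the difference `δ = σ₁ - σ₂ ∈ L¹` and `G = δ ∗ K`
  have hσ₁ : Integrable σ₁ := by simpa [IntegrableOn, Measure.restrict_univ] using h₁.integrableOn_sigma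
  have hσ₂ : Integrable σ₂ := by simpa [IntegrableOn, Measure.restrict_univ] using h₂.integrableOn_sigma
  set δ : ℝ → ℝ := fun Λ => σ₁ Λ - σ₂ Λ with hδ
  have hδi : Integrable δ := hσ₁.sub hσ₂
  set G : ℝ → ℝ := conv δ (cauchyDensity (U / 4)) with hG
  have hGc : Continuous G := continuous_conv hδi hKc hKB
  -- (13): `ρ₁ - ρ₂ = cos k · G(sin k)` on `[-Q, Q]`
  have hρ : ∀ k ∈ Icc (-Q) Q, ρ₁ k - ρ₂ k = Real.cos k * G (Real.sin k) := by
    intro k hk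
    rw [h₁.rho_eq_conv hk, h₂.rho_eq_conv hk, hG, hδ, conv_sub_left hσ₁ hσ₂ hKc hKB]
    ring
  -- the cutoff `a = sin Q ≥ 0` and the truncated `G`
  have hQ := h₁.cutoff_pos
  set a : ℝ := Real.sin Q with ha
  have ha0 : 0 ≤ a := Real.sin_nonneg_of_nonneg_of_le_pi hQ.le h₁.cutoff_le_pi
  set AG : ℝ → ℝ := (Ioc (-a) a).indicator G with hAG
  have hAGle : ∀ y, |AG y| ≤ |G y| := fun y => by
    by_cases hy : y ∈ Ioc (-a) a
    · rw [hAG, indicator_of_mem hy]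
    · rw [hAG, indicator_of_notMem hy, abs_zero]; exact abs_nonneg _
  have hAGi : Integrable AG := by
    rw [hAG, integrable_indicator_iff measurableSet_Ioc]
    exact (hGc.integrableOn_Icc).mono_set Ioc_subset_Icc_self
  -- (14): `δ = AG ∗ K - δ ∗ K²` (substitution `x = sin k` in the `k`-integral)
  have hT : ∀ Λ, (∫ k in -Q..Q, cauchyDensity (U / 4) (Λ - Real.sin k) * ρ₁ k) -
      (∫ k in -Q..Q, cauchyDensity (U / 4) (Λ - Real.sin k) * ρ₂ k) =
        conv AG (cauchyDensity (U / 4)) Λ := by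
    intro Λ
    have hKs : Continuous fun k => cauchyDensity (U / 4) (Λ - Real.sin k) := by fun_prop
    have hg : Continuous fun x => cauchyDensity (U / 4) (Λ - x) * G x := by fun_prop
    have hsub := intervalIntegral.integral_comp_mul_deriv (a := -Q) (b := Q)
      (fun k _ => Real.hasDerivAt_sin k) Real.continuous_cos.continuousOn hg
    rw [Real.sin_neg, ← ha] at hsub
    calc (∫ k in -Q..Q, cauchyDensity (U / 4) (Λ - Real.sin k) * ρ₁ k) -
          (∫ k in -Q..Q, cauchyDensity (U / 4) (Λ - Real.sin k) * ρ₂ k)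
        = ∫ k in -Q..Q, (cauchyDensity (U / 4) (Λ - Real.sin k) * ρ₁ k -
            cauchyDensity (U / 4) (Λ - Real.sin k) * ρ₂ k) :=
          (intervalIntegral.integral_sub (h₁.intervalIntegrable_rho.continuousOn_mul hKs.continuousOn)
            (h₂.intervalIntegrable_rho.continuousOn_mul hKs.continuousOn)).symm
      _ = ∫ k in -Q..Q, ((fun x => cauchyDensity (U / 4) (Λ - x) * G x) ∘ Real.sin) k * Real.cos k := by
          refine intervalIntegral.integral_congr fun k hk => ?_
          rw [uIcc_of_le (by linarith)] at hk
          simp only [Function.comp_apply]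
          rw [← mul_sub, hρ k hk]
          ring
      _ = ∫ x, (Ioc (-a) a).indicator (fun x => cauchyDensity (U / 4) (Λ - x) * G x) x := by
          rw [hsub, intervalIntegral.integral_of_le (by linarith), MeasureTheory.integral_indicator measurableSet_Ioc]
      _ = conv AG (cauchyDensity (U / 4)) Λ := by
          refine MeasureTheory.integral_congr_ae (Eventually.of_forall fun t => ?_)
          beta_reduce
          by_cases ht : t ∈ Ioc (-a) a
          · rw [indicator_of_mem ht, hAG, indicator_of_mem ht]; ring
          · rw [indicator_of_notMem ht, hAG, indicator_of_notMem ht, zero_mul]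
  have hE : ∀ Λ, δ Λ = conv AG (cauchyDensity (U / 4)) Λ - conv δ (cauchyDensity (U / 2)) Λ := by
    intro Λ
    rw [← hT Λ, hδ, conv_sub_left hσ₁ hσ₂ hK2c hK2B]
    dsimp only
    rw [h₁.sigma_eq_conv Λ, h₂.sigma_eq_conv Λ]
    ring
  -- the kernel identities of `LiebWuKernels` in `conv` form, and the contraction step
  have hKu : ∀ y, conv (cauchyDensity (U / 4)) (fermiKernel (U / 4)) y =
      cauchyDensity (U / 4) y - sechKernel (U / 4) y / 2 := fun y => by
    rw [conv_comm]; exact integral_fermiKernel_mul_cauchyDensity hc y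
  have hK2u : ∀ y, conv (cauchyDensity (U / 2)) (fermiKernel (U / 4)) y =
      cauchyDensity (U / 2) y - fermiKernel (U / 4) y := fun y => by
    rw [conv_comm, ← hU2]; exact integral_fermiKernel_mul_cauchyDensity_two_mul hc y
  have hKr : ∀ y, conv (cauchyDensity (U / 4)) (sechKernel (U / 4)) y = 2 * fermiKernel (U / 4) y :=
    fun y => by rw [conv_comm]; exact integral_sechKernel_mul_cauchyDensity hc y
  have hU1 : ∫ x, fermiKernel (U / 4) x < 1 := by rw [integral_fermiKernel hc]; norm_num
  have hδ0 : δ =ᵐ[volume] 0 :=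
    ae_eq_zero_of_system hδi hAGi hAGle hKc (integrable_cauchyDensity hc.le) hKB
      (fun y => (cauchyDensity_pos hc y).le) hK2c (integrable_cauchyDensity h2c.le) hK2B
      (continuous_fermiKernel hc) (integrable_fermiKernel hc)
      (fun y => by rw [abs_of_nonneg (fermiKernel_nonneg hc y)]; exact fermiKernel_le hc y)
      (fun y => fermiKernel_nonneg hc y) hU1 (continuous_sechKernel hc)
      (fun y => by rw [abs_of_pos (sechKernel_pos hc y)]; exact sechKernel_le hc y)
      (fun y => (sechKernel_pos hc y).le) hKu hK2u hKr hE
  -- `G ≡ 0`, hence `AG ≡ 0`, hence `δ ≡ 0` everywhere by (14)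
  have hconv0 : ∀ (g : ℝ → ℝ) (y : ℝ), conv δ g y = 0 := by
    intro g y
    rw [conv, MeasureTheory.integral_congr_ae (g := fun _ => (0 : ℝ)) ?_, MeasureTheory.integral_zero]
    filter_upwards [hδ0] with t ht
    rw [ht, Pi.zero_apply, zero_mul]
  have hAG0 : AG = fun _ => 0 := by
    funext y
    by_cases hy : y ∈ Ioc (-a) a
    · rw [hAG, indicator_of_mem hy, hG, hconv0]
    · rw [hAG, indicator_of_notMem hy]
  funext Λ
  have h := hE Λ
  rw [hAG0, hconv0, conv] at h
  simp only [zero_mul, MeasureTheory.integral_zero, sub_zero] at h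
  exact sub_eq_zero.mp h

/-- **Lieb–Wu 2003, Theorem 1 (uniqueness), case `B = ∞`: the momentum density is unique on `[-Q, Q]`.**
[cite: LiebWuPhysicaA2003, §5, Theorem 1] -/
theorem IsLiebWuDensities.rho_unique (hU : 0 < U) (h₁ : IsLiebWuDensities U Q univ ρ₁ σ₁)
    (h₂ : IsLiebWuDensities U Q univ ρ₂ σ₂) {k : ℝ} (hk : k ∈ Icc (-Q) Q) : ρ₁ k = ρ₂ k := by
  rw [h₁.rho_eq_conv hk, h₂.rho_eq_conv hk, IsLiebWuDensities.sigma_unique hU h₁ h₂]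

/-- Consequently the filling (15) and the energy per site (17) of a `B = ∞` solution are determined by
`(U, Q)`: a value of `IsLiebWuEnergyAt U n` is fixed by the cutoff of any witness.
[cite: LiebWuPhysicaA2003, §5, Theorem 1] -/
theorem IsLiebWuDensities.filling_energyPerSite_unique (hU : 0 < U)
    (h₁ : IsLiebWuDensities U Q univ ρ₁ σ₁) (h₂ : IsLiebWuDensities U Q univ ρ₂ σ₂) :
    liebWuFilling Q ρ₁ = liebWuFilling Q ρ₂ ∧ liebWuEnergyPerSite Q ρ₁ = liebWuEnergyPerSite Q ρ₂ := by
  have h : ∀ k ∈ uIcc (-Q) Q, ρ₁ k = ρ₂ k := fun k hk =>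
    IsLiebWuDensities.rho_unique hU h₁ h₂ (by rwa [uIcc_of_le (by linarith [h₁.cutoff_pos])] at hk)
  refine ⟨intervalIntegral.integral_congr h, ?_⟩
  rw [liebWuEnergyPerSite, liebWuEnergyPerSite]
  congr 1
  exact intervalIntegral.integral_congr fun k hk => by rw [h k hk]

end Uniqueness

end Literature.MathematicalPhysics.QuantumLattice

end
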